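import Summits.FinalStateConjecture.FinalStateConjecture.Theses.ZeroEnergyKerrOrBomb

/-!
# Route ZeroEnergyKerrOrBomb — the glue `KerrOrBombOfCruxes`

Support item `stmt-FinalStateConjecture-10022` of route `ZeroEnergyKerrOrBomb` for the Final State
Conjecture: the propositional glue

`ZeroEnergyRigidity → ErgoregionBomb → KerrOrBomb`.

A mode-stable smooth stationary asymptotically flat vacuum black hole (the telescope of the
target `KerrOrBomb`) carries no trapped zero-energy null ray: if it did, `ErgoregionBomb` would
hand an exponentially growing Killing-mode pair `(ψ, χ)` of `□_g`, regular at the future horizon,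
outgoing, and not identically zero on the domain of outer communications — which the
mode-stability hypothesis forces to vanish identically there, a contradiction. Hence the
no-trapping hypothesis of `ZeroEnergyRigidity` holds and the domain of outer communications is
isometric to a subextremal Kerr exterior. Classical logic only (the three telescopes are
character-identical).
-/

-- every `Summit.FinalStateConjecture.FinalStateConjecture.…` name repeats the summit = sub-problem
-- segment (D-0017 layout, CONVENTIONS §2); the duplicate is deliberate.
set_option linter.dupNamespace false

namespace Summit.FinalStateConjecture.FinalStateConjecture.Theorems

open Summit.FinalStateConjecture.FinalStateConjecture.Theses.ZeroEnergyKerrOrBomb in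
/-- **Glue of route ZeroEnergyKerrOrBomb** (item `stmt-FinalStateConjecture-10022`):
`ZeroEnergyRigidity → ErgoregionBomb → KerrOrBomb`.
Given a mode-stable hole `𝓑` as in the telescope of `KerrOrBomb`, apply `ZeroEnergyRigidity`;
its no-trapped-zero-energy-ray hypothesis is proved by contradiction: a ray `γ` confined to a
compact `K ⊆ 𝓑.doc` is fed to `ErgoregionBomb`, whose growing Killing-mode pair `(ψ, χ)` is
killed on `𝓑.doc` by the mode-stability hypothesis, contradicting its non-vanishing at some
point of `𝓑.doc`. -/
theorem KerrOrBombOfCruxes_proof :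
    Summit.FinalStateConjecture.FinalStateConjecture.Theses.ZeroEnergyKerrOrBomb.KerrOrBombOfCruxes := by
  unfold KerrOrBombOfCruxes
  intro hZ hE 𝓑 _ _ hRic hconn hnd hgh hT hms
  refine hZ 𝓑 hRic hconn hnd hgh hT ?_
  intro γ hgeo hnull K hK hKdoc
  by_contra hcon
  push Not at hcon
  obtain ⟨ν, ω, ψ, χ, hν, hU, hwave, hmode, hbdd, x, hx, hne⟩ :=
    hE 𝓑 hRic hconn hnd hgh hT γ K hgeo hnull hK hKdoc hcon
  have hzero := hms ν ω ψ χ hν hU hwave hmode hbdd x hx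
  rcases hne with h | h
  · exact h hzero.1
  · exact h hzero.2

end Summit.FinalStateConjecture.FinalStateConjecture.Theorems
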